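import Literature.AlgebraicGeometry.Frobenioids.CategoriesFactorization
import Literature.AlgebraicGeometry.Frobenioids.FiniteEtaleBase
import HarnessLib

/-!
# Frobenioids I, §0 p. 18: the exact scope of "an isomorphism is always a mono-minimal categorical
# quotient of its domain by the trivial group" — split-monomorphism rigidity

Mochizuki, *The geometry of Frobenioids I: the general theory*, Kyushu J. Math. **62** (2008) 293–400,
§0 "Categories", kurims text p. 18 [cite: MochizukiFrdI2008, §0 p.18]: after defining categorical
quotients and mono-minimal ones, "Thus, [by total epimorphicity] it follows that an isomorphism is always a
mono-minimal categorical quotient of its domain by the trivial group." In the tree this is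
`IsTotallyEpimorphic.isMonoMinimalQuotient_bot_of_isIso` (`CategoriesFactorization.lean`), the instance form
of the FACT-LIST vocabulary row F-0976 `IsMonoMinimalQuotient` (its universal closure is refuted in
`CategoriesVocabularyClosures.lean`).

THIS PROOF-ONLY FILE (abc-iut cell, block F, seat abc-iut-f-014; no definition, no instance) records the
EXACT hypothesis under which the printed sentence holds, over an ARBITRARY category:

* `isMonoMinimalQuotient_bot_iff_of_isIso` — for an isomorphism `φ : A ⟶ B`,
  `IsMonoMinimalQuotient ⊥ φ ↔ (every split monomorphism out of A is an isomorphism)`;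
  in particular for `𝟙 A` (`isMonoMinimalQuotient_bot_id_iff`);
* `isIso_of_isSplitMono_of_isMonoMinimalQuotient_bot` — more generally the domain of ANY mono-minimal
  categorical quotient by the trivial group is split-mono-rigid, and
  `isIso_of_isSplitMono_of_isMonoMinimalQuotient` — for an arbitrary group `G`, a split monomorphism out of
  the domain along which `G` transports is invertible (the "split-monomorphism obstruction");
* `forall_isMonoMinimalQuotient_bot_iff` — the printed sentence holds for EVERY isomorphism of `C` iff
  every split monomorphism of `C` is invertible, a condition implied by total epimorphicity
  (`IsTotallyEpimorphic.isIso_of_isSplitMono`: epi + split mono) but STRICTLY WEAKER (companion file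
  `CategoriesSplitMonoRigidWitness.lean`, `exists_splitMonoRigid_not_isTotallyEpimorphic`: a three-object
  category with a non-epic arrow and no non-invertible split monomorphism);
* consequences for [FrdI] §0 p. 18 "iso-subanchor" and [FrdII] Def. 3.1 (v) "RC-iso-subanchor":
  `isIsoSubanchor_of_isSubanchor_of_splitMono`, `RC.isRCIsoSubanchor_of_isRCSubanchor_of_splitMono` — over a
  split-mono-rigid object a
  subanchor (resp. RC-subanchor) is an iso-subanchor (resp. RC-iso-subanchor) via `𝟙`.

WHY (cell record). This is the common root, stated once, of the ad-hoc lemmas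
`isMonoMinimalQuotient_bot_id_c/_e` (ArchimedeanProp35iiToyBaseRC), `isMonoMinimalQuotient_id_two`
(ArchimedeanProp35iiCounterexample), `isMonoMinimalQuotient(A)_bot_id_over_c/_e`
(ArchimedeanProp35ivCounterexampleConnected(A)) and of the hypothesis "split monomorphisms of `D` are
invertible" of `ArchFrd.prop35ii_C/_A_of_splitMono`, `prop35iv_C/_A_of_splitMono` (FACT rows
F-0861/F-0862/F-0865/F-0866): total epimorphicity enters [FrdI] §0 p. 18 and [FrdII] Prop. 3.5 (ii)/(iv) only
through split-monomorphism rigidity. Elementary category theory; nothing here bears on [IUTchIII] Cor. 3.12;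
no statement of the paper is strengthened or weakened (print assumes total epimorphicity throughout §0).
-/

namespace Literature.AlgebraicGeometry.Frobenioids

open CategoryTheory

universe v u v' u'

section Categories

variable {C : Type u} [Category.{v} C]

/-! ### The split-monomorphism obstruction to mono-minimality -/

/-- **Split-monomorphism obstruction.** If `f : A ⟶ B` is a mono-minimal categorical quotient of `A` by
`G` and `ζ : A ⟶ A'` is a split monomorphism along which `G` transports (a copy `G' ≅ G` in `Aut A'` with
`γ ≫ ζ = ζ ≫ e γ`), then `ζ` is an isomorphism: `f = ζ ≫ (retraction ζ ≫ f)` is a factorisation through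
the monomorphism `ζ`. [cite: MochizukiFrdI2008, §0 p.18] -/
theorem isIso_of_isSplitMono_of_isMonoMinimalQuotient {A B A' : C} {G : Subgroup (Aut A)} {f : A ⟶ B}
    (hf : IsMonoMinimalQuotient G f) (ζ : A ⟶ A') [IsSplitMono ζ]
    (hG : ∃ (G' : Subgroup (Aut A')) (e : G ≃* G'),
      ∀ γ : G, (γ : Aut A).hom ≫ ζ = ζ ≫ ((e γ : G') : Aut A').hom) :
    IsIso ζ :=
  hf.2 ζ (retraction ζ ≫ f) (by rw [← Category.assoc, IsSplitMono.id, Category.id_comp]) inferInstance hG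

/-- The trivial group transports along every arrow: `⊥ ≤ Aut A` and `⊥ ≤ Aut A'` correspond under the
unique isomorphism, compatibly with any `ζ : A ⟶ A'`. [cite: MochizukiFrdI2008, §0 p.18] -/
theorem bot_transports {A A' : C} (ζ : A ⟶ A') :
    ∃ (G' : Subgroup (Aut A')) (e : (⊥ : Subgroup (Aut A)) ≃* G'),
      ∀ γ : (⊥ : Subgroup (Aut A)), (γ : Aut A).hom ≫ ζ = ζ ≫ ((e γ : G') : Aut A').hom := by
  refine ⟨⊥, MulEquiv.ofUnique, fun γ => ?_⟩
  have h1 : (γ : Aut A) = 1 := (Subgroup.mem_bot).mp γ.2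
  have h2 : ((MulEquiv.ofUnique γ : (⊥ : Subgroup (Aut A'))) : Aut A') = 1 :=
    (Subgroup.mem_bot).mp (MulEquiv.ofUnique γ : (⊥ : Subgroup (Aut A'))).2
  rw [h1, h2]
  change 𝟙 A ≫ ζ = ζ ≫ 𝟙 A'
  rw [Category.id_comp, Category.comp_id]

/-- **The domain of a mono-minimal categorical quotient by the trivial group is split-mono-rigid**: every
split monomorphism out of it is an isomorphism. [cite: MochizukiFrdI2008, §0 p.18] -/
theorem isIso_of_isSplitMono_of_isMonoMinimalQuotient_bot {A B A' : C} {f : A ⟶ B}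
    (hf : IsMonoMinimalQuotient (⊥ : Subgroup (Aut A)) f) (ζ : A ⟶ A') [IsSplitMono ζ] : IsIso ζ :=
  isIso_of_isSplitMono_of_isMonoMinimalQuotient hf ζ (bot_transports ζ)

/-- An isomorphism is a categorical quotient of its domain by the trivial group, in ANY category (no
epimorphicity needed for this half). [cite: MochizukiFrdI2008, §0 p.18] -/
theorem isCategoricalQuotient_bot_of_isIso {A B : C} (φ : A ⟶ B) [IsIso φ] :
    IsCategoricalQuotient (⊥ : Subgroup (Aut A)) φ := by
  refine ⟨fun γ hγ => ?_, fun X ψ _ => ?_⟩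
  · rw [Subgroup.mem_bot] at hγ
    subst hγ
    exact Category.id_comp φ
  · refine ⟨inv φ ≫ ψ, by simp, fun ψ' hψ' => ?_⟩
    rw [← hψ', IsIso.inv_hom_id_assoc]

/-- **Exact scope of [FrdI] §0 p. 18 "an isomorphism is always a mono-minimal categorical quotient of its
domain by the trivial group"**: for an isomorphism `φ : A ⟶ B` of an arbitrary category this holds IF AND
ONLY IF every split monomorphism out of `A` is an isomorphism. (`→`: the obstruction above; `←`: a
factorisation `φ = ζ ≫ φ'` with `φ` invertible makes `ζ` a split monomorphism.)
[cite: MochizukiFrdI2008, §0 p.18] -/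
theorem isMonoMinimalQuotient_bot_iff_of_isIso {A B : C} (φ : A ⟶ B) [IsIso φ] :
    IsMonoMinimalQuotient (⊥ : Subgroup (Aut A)) φ ↔
      ∀ ⦃A' : C⦄ (ζ : A ⟶ A'), IsSplitMono ζ → IsIso ζ := by
  constructor
  · intro h A' ζ hζ
    exact isIso_of_isSplitMono_of_isMonoMinimalQuotient_bot h ζ
  · intro h
    refine ⟨isCategoricalQuotient_bot_of_isIso φ, fun A' ζ φ' hζ _ _ => ?_⟩
    exact h ζ (IsSplitMono.mk' ⟨φ' ≫ inv φ, by rw [← Category.assoc, hζ, IsIso.hom_inv_id]⟩)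

/-- The identity of `A` is a mono-minimal categorical quotient of `A` by the trivial group iff `A` is
split-mono-rigid. [cite: MochizukiFrdI2008, §0 p.18] -/
theorem isMonoMinimalQuotient_bot_id_iff (A : C) :
    IsMonoMinimalQuotient (⊥ : Subgroup (Aut A)) (𝟙 A) ↔
      ∀ ⦃A' : C⦄ (ζ : A ⟶ A'), IsSplitMono ζ → IsIso ζ :=
  isMonoMinimalQuotient_bot_iff_of_isIso (𝟙 A)

variable (C) in
/-- **Category-level form**: the printed sentence holds for EVERY isomorphism of `C` iff every split
monomorphism of `C` is an isomorphism. [cite: MochizukiFrdI2008, §0 p.18] -/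
theorem forall_isMonoMinimalQuotient_bot_iff :
    (∀ ⦃A B : C⦄ (φ : A ⟶ B), IsIso φ → IsMonoMinimalQuotient (⊥ : Subgroup (Aut A)) φ) ↔
      ∀ ⦃A A' : C⦄ (ζ : A ⟶ A'), IsSplitMono ζ → IsIso ζ := by
  constructor
  · intro h A A' ζ hζ
    exact (isMonoMinimalQuotient_bot_id_iff A).mp (h (𝟙 A) inferInstance) ζ hζ
  · intro h A B φ hφ
    exact (isMonoMinimalQuotient_bot_iff_of_isIso φ).mpr (fun A' ζ hζ => h ζ hζ)

/-- In a totally epimorphic category every split monomorphism is an isomorphism (epi + split mono) — which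
is how total epimorphicity yields the printed sentence (`IsTotallyEpimorphic.isMonoMinimalQuotient_bot_of_isIso`
is recovered from `isMonoMinimalQuotient_bot_iff_of_isIso`). [cite: MochizukiFrdI2008, §0 p.18] -/
theorem IsTotallyEpimorphic.isIso_of_isSplitMono (hC : IsTotallyEpimorphic C) {A A' : C} (ζ : A ⟶ A')
    [IsSplitMono ζ] : IsIso ζ := by
  haveI : Epi ζ := hC.epi ζ
  exact isIso_of_epi_of_isSplitMono ζ

/-- Recovery of the tree's instance form from the iff (a one-line check that nothing was lost).
[cite: MochizukiFrdI2008, §0 p.18] -/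
theorem IsTotallyEpimorphic.isMonoMinimalQuotient_bot_of_isIso' (hC : IsTotallyEpimorphic C) {A B : C}
    (φ : A ⟶ B) [IsIso φ] : IsMonoMinimalQuotient (⊥ : Subgroup (Aut A)) φ :=
  (isMonoMinimalQuotient_bot_iff_of_isIso φ).mpr fun _ ζ _ => hC.isIso_of_isSplitMono ζ

/-! ### Consequences for iso-subanchors ([FrdI] §0 p. 18) and RC-iso-subanchors ([FrdII] Def. 3.1 (v)) -/

/-- A subanchor out of which every split monomorphism is invertible is an iso-subanchor — via the identity,
a mono-minimal categorical quotient by the trivial group. [cite: MochizukiFrdI2008, §0 p.18] -/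
theorem isIsoSubanchor_of_isSubanchor_of_splitMono {A : C} (hA : IsSubanchor A)
    (h : ∀ ⦃A' : C⦄ (ζ : A ⟶ A'), IsSplitMono ζ → IsIso ζ) : IsIsoSubanchor A :=
  ⟨A, ⊥, 𝟙 A, hA, (isMonoMinimalQuotient_bot_id_iff A).mpr h⟩

/-- In a totally epimorphic category every subanchor is an iso-subanchor. [cite: MochizukiFrdI2008, §0 p.18] -/
theorem IsTotallyEpimorphic.isIsoSubanchor_of_isSubanchor (hC : IsTotallyEpimorphic C) {A : C}
    (hA : IsSubanchor A) : IsIsoSubanchor A :=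
  isIsoSubanchor_of_isSubanchor_of_splitMono hA fun _ ζ _ => hC.isIso_of_isSplitMono ζ

/-- Conversely, the SOURCE of the quotient exhibiting an iso-subanchor is split-mono-rigid as soon as the
group is trivial. [cite: MochizukiFrdI2008, §0 p.18] -/
theorem isIso_of_isSplitMono_of_isIsoSubanchor_bot {A B A' : C} {f : B ⟶ A}
    (hf : IsMonoMinimalQuotient (⊥ : Subgroup (Aut B)) f) (ζ : B ⟶ A') [IsSplitMono ζ] : IsIso ζ :=
  isIso_of_isSplitMono_of_isMonoMinimalQuotient_bot hf ζ

end Categories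

namespace RC

variable {𝓕 : Type u'} [Category.{v'} 𝓕] (P : 𝓕 ⥤ ArchBase)

/-- An RC-subanchor out of which every split monomorphism is invertible is an RC-iso-subanchor ([FrdII]
Def. 3.1 (v)) — via the identity. [cite: MochizukiFrdII2008, Def 3.1 (v) p.25] -/
theorem isRCIsoSubanchor_of_isRCSubanchor_of_splitMono {A : 𝓕} (hA : IsRCSubanchor P A)
    (h : ∀ ⦃A' : 𝓕⦄ (ζ : A ⟶ A'), IsSplitMono ζ → IsIso ζ) : IsRCIsoSubanchor P A :=
  ⟨A, ⊥, 𝟙 A, hA, (isMonoMinimalQuotient_bot_id_iff A).mpr h⟩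

/-- In a totally epimorphic category every RC-subanchor is an RC-iso-subanchor.
[cite: MochizukiFrdII2008, Def 3.1 (v) p.25] -/
theorem isRCIsoSubanchor_of_isRCSubanchor_of_isTotallyEpimorphic (h𝓕 : IsTotallyEpimorphic 𝓕) {A : 𝓕}
    (hA : IsRCSubanchor P A) : IsRCIsoSubanchor P A :=
  isRCIsoSubanchor_of_isRCSubanchor_of_splitMono P hA fun _ ζ _ => h𝓕.isIso_of_isSplitMono ζ

end RC

end Literature.AlgebraicGeometry.Frobenioids
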